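import Summits.QuantumFields.YangMills.Theorems.BalabanUVNodesK2NamedJetsRunRemAt

/-!
# CRIT-1 g30 ADD3 — kernel for the critic sheet `CRIT-1-ADD3-idea1-g30-fibrewise-same-lever.md` (crux K2⁷ stmt-QuantumFields-20543)

Cell `ym-nodeO-ideate`, CRITIC seat `ym-nodeO-crit-1` gen 30.  HONEST FRAMING: the YM mass gap (Clay) is NOT proved by any of this; route R4
`BalabanUVNodes` closes only the CONDITIONAL finite-𝕋⁴ rung `BalabanLadder.UV`; NODE O ([I] Thm 2 p. 259) is unproved in print; K2⁷ stays OPEN.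
Nothing of Bałaban is asserted here: every `def … : Prop` is a HYPOTHESIS SHAPE restated VERBATIM from the two idea-1 kernels (crux workfiles are not
importable), and what is PROVED is real-number plumbing.

WHAT THIS FILE CERTIFIES (kernel side of ADD3's «same lever» ruling):
* §1 — the FIBREWISE bookkeeping of the two-route identity.  Read at two fixed coarse backgrounds and at two histories `p, q`, [I] (2.13) p. 268 +
  (0.22)–(0.23) p. 256 give `β(p)·ΔS = ΔE(p) − ΔB(p)` and `β(q)·ΔS = ΔE(q) − ΔB(q)` EXACTLY; so the squeeze needs only an oscillation bound on `ΔE`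
  (finite-dimensional, size-dependent constant) and a size-null bound on the subtracted bracket `ΔB` — NO Laplace remainders over the coarse field, NO
  one-loop determinant identification, NO minimality of any background (`abs_sub_le_of_fibrewise`, `abs_sub_anchor_le_of_fibrewise`).
* §2 — the typed deliverables of idea-1's two cards, `TwoParamSqueeze` (two-route kernel `TwoRouteTwistedLaplaceSketch.lean` :76–:80) and
  `ParabolicModulus` (approximant kernel `ApproximantLaplaceSketch.lean` :319–:321), are both instances of ONE run-wise modulus shape
  `RunModulusSqueeze β b ω C γ̄` (`ω` null, `C` size-dependent), and that shape ALONE gives the END's run letter `RunConstRemainder β b s γ` at EVERY cap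
  `s > 0` (`runConstRemainder_of_runModulusSqueeze`); both cards' squeeze-to-remainder steps are recovered as corollaries.  Size `N` of an auxiliary torus
  and depth `r` of the record's own approximant are the same bound variable.
-/

noncomputable section

namespace Summit.QuantumFields.YangMills.Cruxes.EndpointGivenBR13SepCoPH.Crit1Add3SameLever

open Filter Topology
open Literature.MathematicalPhysics.QuantumFieldTheory.Balaban1983to89
open Literature.MathematicalPhysics.QuantumFieldTheory.Balaban1983to89.FlowStep
open Literature.MathematicalPhysics.QuantumFieldTheory.Balaban1983to89.B12Beta (HistBox)
open Summit.QuantumFields.YangMills.Theorems.BalabanUVNodesK2NamedJetsRunRemAt (RunConstRemainder)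

/-! ## §1 Fibrewise bookkeeping of the two-route identity (real numbers; proved) -/

/-- **FIBREWISE SQUEEZE, ONE STEP, TWO HISTORIES.**  If `βp·ΔS = ΔEp − ΔBp` and `βq·ΔS = ΔEq − ΔBq` (the identity (2.13)∕(0.23) read at two coarse
backgrounds, at histories `p` and `q`), `ΔS > 0`, `|ΔEp − ΔEq| ≤ e` (finite-dimensional oscillation of the step free-energy difference) and `|ΔBp| ≤ l`,
`|ΔBq| ≤ l` (size-null bound on the marginal-subtracted bracket), then `|βp − βq| ≤ (e + 2l)/ΔS`.  No determinant term, no Laplace remainder occurs. [folklore] -/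
theorem abs_sub_le_of_fibrewise {βp βq ΔS ΔEp ΔEq ΔBp ΔBq e l : ℝ} (hS : 0 < ΔS)
    (hp : βp * ΔS = ΔEp - ΔBp) (hq : βq * ΔS = ΔEq - ΔBq) (hE : |ΔEp - ΔEq| ≤ e) (hBp : |ΔBp| ≤ l) (hBq : |ΔBq| ≤ l) :
    |βp - βq| ≤ (e + 2 * l) / ΔS := by
  rw [le_div_iff₀ hS]
  have eq : (βp - βq) * ΔS = (ΔEp - ΔEq) + (-ΔBp) + ΔBq := by linear_combination hp - hq
  have hnum : |(βp - βq) * ΔS| ≤ e + 2 * l := by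
    rw [eq]
    calc |(ΔEp - ΔEq) + (-ΔBp) + ΔBq| ≤ |(ΔEp - ΔEq) + (-ΔBp)| + |ΔBq| := abs_add_le _ _
      _ ≤ |ΔEp - ΔEq| + |-ΔBp| + |ΔBq| := by gcongr; exact abs_add_le _ _
      _ ≤ e + l + l := by rw [abs_neg]; gcongr
      _ = e + 2 * l := by ring
  simpa [abs_mul, abs_of_pos hS] using hnum

/-- **… PLUS THE LETTER'S OWN ANCHOR.**  With `|βq − b| ≤ δ` (the `ScaleAnchor` clause of `RunRemAt`, read at a history `q` deep in the anchor's box) the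
centring at the named number `b` follows: `|βp − b| ≤ (e + 2l)/ΔS + δ` — the one-loop determinant is never identified with anything. [folklore] -/
theorem abs_sub_anchor_le_of_fibrewise {βp βq b ΔS ΔEp ΔEq ΔBp ΔBq e l δ : ℝ} (hS : 0 < ΔS)
    (hp : βp * ΔS = ΔEp - ΔBp) (hq : βq * ΔS = ΔEq - ΔBq) (hE : |ΔEp - ΔEq| ≤ e) (hBp : |ΔBp| ≤ l) (hBq : |ΔBq| ≤ l)
    (hanch : |βq - b| ≤ δ) : |βp - b| ≤ (e + 2 * l) / ΔS + δ := by
  have h1 := abs_sub_le_of_fibrewise hS hp hq hE hBp hBq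
  calc |βp - b| = |(βp - βq) + (βq - b)| := by ring_nf
    _ ≤ |βp - βq| + |βq - b| := abs_add_le _ _
    _ ≤ (e + 2 * l) / ΔS + δ := add_le_add h1 hanch

/-! ## §2 One run-modulus shape behind both idea-1 cards (hypothesis shapes restated verbatim; plumbing proved) -/

section Shapes

variable {β : HBeta} {b : ℕ → ℝ}

/-- VERBATIM restatement of the two-route kernel's `TwoParamSqueeze` (`Cruxes/EndpointGivenBR13SepCoPH/TwoRouteTwistedLaplaceSketch.lean` :76–:80;
idea-1 g10): along in-window runs, `|β_k − b_k| ≤ C₁/N⁴ + C₂(N)·γ²` for every auxiliary size `N ≥ 1` and level `γ ≤ γ̄`.  HYPOTHESIS SHAPE, never a fact. [folklore] -/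
def TwoParamSqueeze (β : HBeta) (b : ℕ → ℝ) (C₁ : ℝ) (C₂ : ℕ → ℝ) (γbar : ℝ) : Prop :=
  ∀ N : ℕ, 0 < N → ∀ γ : ℝ, 0 < γ → γ ≤ γbar →
    ∀ (n : ℕ) (gs : ℕ → ℝ), RGEqH n β gs → Step.InInterval γ n gs →
      ∀ k, k ≤ n → |β k (prefixOf gs k) - b k| ≤ C₁ / (N : ℝ) ^ 4 + C₂ N * γ ^ 2

/-- VERBATIM restatement of the approximant kernel's `ParabolicModulus` (`Cruxes/EndpointGivenBR13SepCoPH/ApproximantLaplaceSketch.lean` :319–:321;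
idea-1 g12–g13, the collapse-certificate form of `ApproxLaplacePkg`): box-wise, `|β_k(v) − b_k| ≤ τ_r + C_r·‖v‖²` for every depth `r`.  HYPOTHESIS SHAPE. [folklore] -/
def ParabolicModulus (β : HBeta) (b : ℕ → ℝ) (C τ : ℕ → ℝ) (γbar : ℝ) : Prop :=
  ∀ (r k : ℕ) (v : Fin (k + 1) → ℝ), v ∈ HistBox γbar k → |β k v - b k| ≤ τ r + C r * ‖v‖ ^ 2

/-- **THE COMMON SHAPE — RUN-WISE MODULUS SQUEEZE**: for every size∕depth label `N` and level `0 < γ ≤ γ̄`, along every in-window solution of (0.20),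
`|β_k − b_k| ≤ ω(N) + C(N)·γ²`.  (`ω` is meant null; `C` may blow up with `N`.)  HYPOTHESIS SHAPE, never a fact. [folklore] -/
def RunModulusSqueeze (β : HBeta) (b : ℕ → ℝ) (ω C : ℕ → ℝ) (γbar : ℝ) : Prop :=
  ∀ (N : ℕ) (γ : ℝ), 0 < γ → γ ≤ γbar →
    ∀ (n : ℕ) (gs : ℕ → ℝ), RGEqH n β gs → Step.InInterval γ n gs →
      ∀ k, k ≤ n → |β k (prefixOf gs k) - b k| ≤ ω N + C N * γ ^ 2

/-- two-route's squeeze IS a run-modulus squeeze (`ω N := C₁/(N+1)⁴`, `C N := C₂(N+1)`; the shift only avoids `N = 0`). [folklore] -/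
theorem runModulusSqueeze_of_twoParamSqueeze {C₁ γbar : ℝ} {C₂ : ℕ → ℝ} (h : TwoParamSqueeze β b C₁ C₂ γbar) :
    RunModulusSqueeze β b (fun N => C₁ / ((N : ℝ) + 1) ^ 4) (fun N => C₂ (N + 1)) γbar := by
  intro N γ hγ hγle n gs hrg hI k hk
  have h1 := h (N + 1) (Nat.succ_pos N) γ hγ hγle n gs hrg hI k hk
  push_cast at h1
  exact h1

/-- approximant's parabolic modulus IS a run-modulus squeeze (`ω := τ`; box ⟹ runs, `‖prefix‖ ≤ γ` on an in-window run). [folklore] -/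
theorem runModulusSqueeze_of_parabolicModulus {C τ : ℕ → ℝ} {γbar : ℝ} (hC : ∀ r, 0 ≤ C r) (h : ParabolicModulus β b C τ γbar) :
    RunModulusSqueeze β b τ C γbar := by
  intro N γ hγ hγle n gs _hrg hI k hk
  have hi : ∀ i : Fin (k + 1), 0 < gs i ∧ gs i ≤ γ := fun i => hI i ((Nat.lt_succ_iff.mp i.isLt).trans hk)
  have hmem : prefixOf gs k ∈ HistBox γbar k := fun i => ⟨(hi i).1, (hi i).2.trans hγle⟩
  have hnorm : ‖prefixOf gs k‖ ≤ γ := by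
    refine (pi_norm_le_iff_of_nonneg hγ.le).2 fun i => ?_
    rw [prefixOf_apply, Real.norm_eq_abs, abs_of_pos (hi i).1]
    exact (hi i).2
  calc |β k (prefixOf gs k) - b k| ≤ τ N + C N * ‖prefixOf gs k‖ ^ 2 := h N k _ hmem
    _ ≤ τ N + C N * γ ^ 2 := by gcongr; exact hC N

/-- **RUN-MODULUS SQUEEZE WITH NULL `ω` ⟹ THE RUN-WISE CONSTANT REMAINDER AT EVERY CAP** (choose `N` with `ω(N) < s/2`, then
`γ := min(γ̄, 1, s/(2(C(N)+1)))`).  This is the ONE real-analysis step both idea-1 cards use to meet the END's `hrem` letter. [folklore] -/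
theorem runConstRemainder_of_runModulusSqueeze {ω C : ℕ → ℝ} {γbar : ℝ} (hγ : 0 < γbar) (hC : ∀ N, 0 ≤ C N)
    (hω : Tendsto ω atTop (𝓝 0)) (h : RunModulusSqueeze β b ω C γbar) {s : ℝ} (hs : 0 < s) :
    ∃ γ : ℝ, 0 < γ ∧ γ ≤ γbar ∧ RunConstRemainder β b s γ := by
  -- choose the label N
  have hev : ∀ᶠ N in atTop, ω N < s / 2 := hω.eventually (gt_mem_nhds (by linarith))
  obtain ⟨N, hN⟩ := hev.exists
  -- choose the level γ
  set c : ℝ := C N with hc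
  have hc0 : 0 ≤ c := hC N
  set γ : ℝ := min γbar (min 1 (s / (2 * (c + 1)))) with hγdef
  have hpos : 0 < γ := lt_min hγ (lt_min one_pos (by positivity))
  refine ⟨γ, hpos, min_le_left _ _, ?_⟩
  intro n gs hrg hI k hk
  have hb := h N γ hpos (min_le_left _ _) n gs hrg hI k hk
  have hle1 : γ ≤ 1 := (min_le_right _ _).trans (min_le_left _ _)
  have hles : γ ≤ s / (2 * (c + 1)) := (min_le_right _ _).trans (min_le_right _ _)
  have hsq : γ ^ 2 ≤ s / (2 * (c + 1)) := by
    calc γ ^ 2 = γ * γ := sq _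
      _ ≤ 1 * (s / (2 * (c + 1))) := by gcongr
      _ = s / (2 * (c + 1)) := one_mul _
  have hsecond : c * γ ^ 2 ≤ s / 2 := by
    calc c * γ ^ 2 ≤ c * (s / (2 * (c + 1))) := by gcongr
      _ ≤ (c + 1) * (s / (2 * (c + 1))) := by gcongr; linarith
      _ = s / 2 := by field_simp
  calc |β k (prefixOf gs k) - b k| ≤ ω N + c * γ ^ 2 := hb
    _ ≤ s / 2 + s / 2 := add_le_add hN.le hsecond
    _ = s := by ring

/-- COROLLARY (two-route's `runConstRemainder_of_twoParamSqueeze`, kernel :82, recovered THROUGH the common shape). [folklore] -/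
theorem runConstRemainder_of_twoParamSqueeze {C₁ γbar : ℝ} {C₂ : ℕ → ℝ} (hγ : 0 < γbar) (hC₂ : ∀ N, 0 ≤ C₂ N)
    (h : TwoParamSqueeze β b C₁ C₂ γbar) {s : ℝ} (hs : 0 < s) :
    ∃ γ : ℝ, 0 < γ ∧ γ ≤ γbar ∧ RunConstRemainder β b s γ := by
  refine runConstRemainder_of_runModulusSqueeze hγ (fun N => hC₂ (N + 1)) ?_ (runModulusSqueeze_of_twoParamSqueeze h) hs
  -- `C₁/(N+1)⁴ → 0`
  have h1 : Tendsto (fun N : ℕ => ((N : ℝ) + 1) ^ 4) atTop atTop :=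
    (tendsto_pow_atTop (by norm_num)).comp (tendsto_natCast_atTop_atTop.atTop_add tendsto_const_nhds)
  simpa [div_eq_mul_inv] using h1.inv_tendsto_atTop.const_mul C₁

/-- COROLLARY (approximant's box-to-runs remainder step, `constRemainder_bInf` + `runConstRemainder_of_constRemainder`, recovered THROUGH the common shape). [folklore] -/
theorem runConstRemainder_of_parabolicModulus {C τ : ℕ → ℝ} {γbar : ℝ} (hγ : 0 < γbar) (hC : ∀ r, 0 ≤ C r)
    (hτ : Tendsto τ atTop (𝓝 0)) (h : ParabolicModulus β b C τ γbar) {s : ℝ} (hs : 0 < s) :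
    ∃ γ : ℝ, 0 < γ ∧ γ ≤ γbar ∧ RunConstRemainder β b s γ :=
  runConstRemainder_of_runModulusSqueeze hγ hC hτ (runModulusSqueeze_of_parabolicModulus hC h) hs

end Shapes

end Summit.QuantumFields.YangMills.Cruxes.EndpointGivenBR13SepCoPH.Crit1Add3SameLever
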